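/-
Copyright (c) 2026 the pub-hodgecm-mathlib formalisation cell (harness21).  Prover seat hodgecm-mathlib-K2Liu-p13 (g3), Track B «K2-LIT»,
#184♮ = hLiu418 = `stmt-HodgeConjecture-24832`; ROAD Φ (RULING «M-156n»), consumer sheet fa2b1e3a29709f09 row G6-fin — the big-cell term package ★
`K2LiuSiegelEisensteinBigCellTermPackage.exists_bigCell_termPackage` with its SCALAR LETTER discharged at the K2_Liu frame (`n = 2`, parity `χ⁰ = ε_{L∕L⁺}`):
`P₈ = {½}`, `r = a^S∕b^S`, `G` = ★ O41.6 `K2LiuSiegelIntertwiningScalarGL1.exists_differentiableOn_sub_half_mul_scalar_cm`.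
THEOREMS ONLY (no `def`, no `instance`, no named-fact hypothesis, no `sorry`).
-/
import Summits.HodgeConjecture.HodgeConjecture.Theorems.K2LiuSiegelEisensteinBigCellTermPackage   -- ★ `exists_bigCell_termPackage`
import Summits.HodgeConjecture.HodgeConjecture.Theorems.K2LiuSiegelIntertwiningScalarGL1        -- ★ O41.6 the GL₁ scalar `a^S∕b^S`
import HarnessLib

/-!
# Crux `HLiu418`, ROAD Φ, organ Φ8 (sheet row G6-fin): THE BIG-CELL TERM PACKAGE AT THE K2_Liu FRAME — `P₈ = {½}`, scalar `a^S∕b^S` BY NAME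

Cell `hodgecm-mathlib`, crux item hLiu418 = `stmt-HodgeConjecture-24832` (helper lane, count-neutral).  Frame `n = 2` (`e : Fin 2 × Fin 1 ≃ Fin n`; the hypothesis `hn : n = 2` is ★ `K2LiuArchDoubledSignFrameTwo.eq_two_of_frame`),
`H(𝔸) = U(2,2)(𝔸_{L⁺})` doubled, parity `χ|_{𝔸_{L⁺}^×} = ε = ε_{L∕L⁺}` (REPORT-FIRST #41 (B4)).  ★ O41.6 (K2Liu-p07) continued the global Gindikin–Karpelevich
scalar `r(s) = a^S(s)∕b^S(s)`, `a^S(s) = ζ^S(2s)L^S(2s−1,ε)`, `b^S(s) = ζ^S(2s+1)L^S(2s+2,ε)`, to `{0 < re}` as `G(s)∕(s − ½)` with `G` holomorphic; ★ `hasProd_a`∕`hasProd_b`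
make `a^S, b^S ≠ 0` on `re s > 1 = n∕2`.  Feeding ★ `exists_bigCell_termPackage` with `P := {½}`, `r := a^S∕b^S`, `a := b^S∕a^S`:
**`exists_bigCell_termPackage_cm`** — for a standard family `f` (socket's `hstd`, `hcont`), unitary `χ`, a finite set `S` of finite places of `L⁺` off which `ε` is
unramified, and the CONTINUATION `E` of the normalised big cell `(b^S∕a^S)(s)·M(s)f_s` (`hEd`, `hEeq` — the one by-value letter left: factorisation + GK + arch
ladder), there is `Ec₈` with (i) holomorphy on `{0<re}`, (ii) continuity in `h`, (iv) `Ec₈ s h = (s − ½)·M(s)f_s(h)` on `re s > 1`, (v) growth in `adelicHeightGL 4`.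
Sources: [Tan1999, §3]; [Harris2007, (1.3.4)]; [KudlaSweet1997, §1]; [Garrett2018, §3.12]; [MoeglinWaldspurger1995, IV.1].
HONEST LABEL.  Helper lemmas, count-neutral; `HC_CM` is proved only modulo the 7 printed citations (2 remaining named inputs:
hLiu418 = `stmt-HodgeConjecture-24832`, h413 = `stmt-HodgeConjecture-24833`) until rung 0 closes.
-/

set_option autoImplicit false
set_option linter.dupNamespace false -- the mandated namespace repeats `HodgeConjecture.HodgeConjecture`

noncomputable section

open scoped Matrix NNReal ENNReal
open NumberField IsDedekindDomain MeasureTheory MeasureTheory.Measure Metric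

namespace Summit.HodgeConjecture.HodgeConjecture.Cruxes.HLiu418.K2LiuSiegelEisensteinBigCellTermPackageCM

open Literature.NumberTheory.GelbartRogawski1991.AdaptedBlocks
open Literature.NumberTheory.Automorphic Literature.NumberTheory.Automorphic.UnitaryGroup
open Literature.NumberTheory.GelbartRogawski1991 Literature.NumberTheory.GelbartRogawski1991.GRConstruction
open Literature.NumberTheory.K2Lit.SiegelDoubled Literature.NumberTheory.GaloisRepresentations Literature.NumberTheory.LFunctions
open Literature.RepresentationTheory.HarrisKudlaSweet1996 (isFiniteOrder_quadraticHeckeCharCM)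
open UnitaryDualPair
open Summit.HodgeConjecture.HodgeConjecture.Cruxes.HLiu418.K2LiuSiegelEisensteinBigCellTermPackage (exists_bigCell_termPackage)
open Summit.HodgeConjecture.HodgeConjecture.Cruxes.HLiu418.K2LiuSiegelIntertwiningScalarGL1

variable (L : Type) [Field L] [NumberField L] [IsCMField L]
variable {N M n : ℕ} (e : Fin N × Fin M ≃ Fin n)
  (dV : Fin N → L) (hdV : ∀ i, IsCMField.complexConj L (dV i) = dV i)
  (dW : Fin M → L) (hdW : ∀ i, IsCMField.complexConj L (dW i) = dW i)

/-! ## §1 Frame bookkeeping -/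

/-- `∏_{p ∈ {½}} (s − p) = s − ½`. [folklore] -/
theorem prod_singleton_half (s : ℂ) : (∏ p ∈ ({(1 / 2 : ℂ)} : Finset ℂ), (s - p)) = s - 1 / 2 :=
  Finset.prod_singleton _ _

/-! ## §2 The big-cell term package at the K2_Liu frame -/

/-- **THE BIG-CELL TERM PACKAGE AT THE K2_Liu FRAME (`n = 2`, `P₈ = {½}`, scalar `a^S∕b^S` of ★ O41.6 BY NAME).**  Given the frame, an Iwasawa datum, a Haar
measure on `N_Δ(𝔸)`, a unitary `χ`, a standard family `f` with continuous members, a finite set `S` of finite places of `L⁺` off which `ε_{L∕L⁺}` is unramified, and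
the continuation `E` (holomorphic on `{0<re}` per `h`) of `(b^S∕a^S)(s)·M(s)f_s(h)` from `re s > 1`: there is `Ec₈` holomorphic on `{0<re}` per `h`, continuous in
`h` for `0 < re s`, equal to `(∏_{p∈{½}}(s−p))·M(s)f_s(h)` on `re s > n∕2 = 1`, of moderate growth in `adelicHeightGL (n+n)` locally uniformly on `{0<re}`.
[cite: Tan1999, §3] [cite: Harris2007, (1.3.4) p. 92] [cite: KudlaSweet1997, §1] [cite: Garrett2018, §3.12] -/
theorem exists_bigCell_termPackage_cm (hn : n = 2) (hdV0 : ∀ i, dV i ≠ 0) (hdW0 : ∀ i, dW i ≠ 0) (𝒦 : IwasawaDatum L e dV hdV dW hdW)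
    [MeasurableSpace (unipDelta L e dV hdV dW hdW)] [BorelSpace (unipDelta L e dV hdV dW hdW)]
    (νN : Measure (unipDelta L e dV hdV dW hdW)) [νN.IsHaarMeasure] (χ : HeckeCharacter L) (hχ : χ.IsUnitary)
    (f : ℂ → HA L e dV hdV dW hdW → ℂ) (hstd : IsStandardSectionFamily 𝒦 χ f) (hcont : ∀ s, Continuous (f s))
    {S : Set (HeightOneSpectrum (𝓞 ↥(maximalRealSubfield L)))} (hS : S.Finite) (hur : ∀ v ∉ S, (quadraticHeckeCharCM L).IsUnramifiedAt v)
    (E : ℂ → HA L e dV hdV dW hdW → ℂ) (hEd : ∀ x : HA L e dV hdV dW hdW, DifferentiableOn ℂ (fun s : ℂ => E s x) {s : ℂ | 0 < s.re})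
    (hEeq : ∀ (s : ℂ) (x : HA L e dV hdV dW hdW), (n : ℝ) / 2 < s.re →
      E s x = (partialStandardL S (fun _ => {1}) (2 * s + 1) * partialStandardL S (fun v => {(quadraticHeckeCharCM L).valueAtUniformizer v}) (2 * s + 2)) /
          (partialStandardL S (fun _ => {1}) (2 * s) * partialStandardL S (fun v => {(quadraticHeckeCharCM L).valueAtUniformizer v}) (2 * s - 1)) *
        intertwiningDelta L e dV hdV dW hdW νN (f s) x) :
    ∃ Ec₈ : ℂ → HA L e dV hdV dW hdW → ℂ,
      (∀ h : HA L e dV hdV dW hdW, DifferentiableOn ℂ (fun s => Ec₈ s h) {s : ℂ | 0 < s.re}) ∧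
      (∀ s : ℂ, 0 < s.re → Continuous (Ec₈ s)) ∧
      (∀ (s : ℂ) (h : HA L e dV hdV dW hdW), (n : ℝ) / 2 < s.re →
        Ec₈ s h = (∏ p ∈ ({(1 / 2 : ℂ)} : Finset ℂ), (s - p)) * intertwiningDelta L e dV hdV dW hdW νN (f s) h) ∧
      (∀ z : ℂ, 0 < z.re → ∃ C A ρ : ℝ, 0 < ρ ∧ ∀ s : ℂ, dist s z < ρ → ∀ h : HA L e dV hdV dW hdW,
        ‖Ec₈ s h‖ ≤ C * adelicHeightGL (n + n) L (h : GL (Fin (n + n)) (AdeleRing (𝓞 L) L)) ^ A) := by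
  haveI : NeZero n := ⟨by omega⟩
  have hn2 : (n : ℝ) / 2 = 1 := by rw [hn]; norm_num
  have hε : (quadraticHeckeCharCM L).IsUnitary := (isFiniteOrder_quadraticHeckeCharCM (L := L)).isUnitary
  obtain ⟨G, hG, hGeq⟩ := exists_differentiableOn_sub_half_mul_scalar_cm L hS hur
  refine exists_bigCell_termPackage L e dV hdV dW hdW hdV0 hdW0 𝒦 νN χ hχ f hstd hcont {(1 / 2 : ℂ)}
    (fun s => (partialStandardL S (fun _ => {1}) (2 * s) * partialStandardL S (fun v => {(quadraticHeckeCharCM L).valueAtUniformizer v}) (2 * s - 1)) /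
      (partialStandardL S (fun _ => {1}) (2 * s + 1) * partialStandardL S (fun v => {(quadraticHeckeCharCM L).valueAtUniformizer v}) (2 * s + 2)))
    G hG (fun s hs => ?_)
    (fun s => (partialStandardL S (fun _ => {1}) (2 * s + 1) * partialStandardL S (fun v => {(quadraticHeckeCharCM L).valueAtUniformizer v}) (2 * s + 2)) /
      (partialStandardL S (fun _ => {1}) (2 * s) * partialStandardL S (fun v => {(quadraticHeckeCharCM L).valueAtUniformizer v}) (2 * s - 1)))
    (fun s hs => ?_) E hEd hEeq
  · -- `(s − ½)·(a^S∕b^S)(s) = G(s)` on `re s > 1`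
    have hs1 : 1 < s.re := by rw [hn2] at hs; exact hs
    rw [prod_singleton_half]
    exact hGeq s hs1
  · -- `r(s)·a(s) = 1` on `re s > 1` (`a^S, b^S ≠ 0` there)
    have hs1 : 1 < s.re := by rw [hn2] at hs; exact hs
    have ha := (hasProd_a (S := S) hε hs1).2
    have hb := (hasProd_b (S := S) hε (lt_trans one_pos hs1)).2
    rw [div_mul_div_comm, mul_comm (partialStandardL S (fun _ => {1}) (2 * s) * _), div_self (mul_ne_zero hb ha)]

/-- the same with clause (iv) spelled `Ec₈ s h = (s − ½)·M(s)f_s(h)`. [cite: Tan1999, §3] [cite: KudlaSweet1997, §1] -/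
theorem exists_bigCell_termPackage_cm' (hn : n = 2) (hdV0 : ∀ i, dV i ≠ 0) (hdW0 : ∀ i, dW i ≠ 0) (𝒦 : IwasawaDatum L e dV hdV dW hdW)
    [MeasurableSpace (unipDelta L e dV hdV dW hdW)] [BorelSpace (unipDelta L e dV hdV dW hdW)]
    (νN : Measure (unipDelta L e dV hdV dW hdW)) [νN.IsHaarMeasure] (χ : HeckeCharacter L) (hχ : χ.IsUnitary)
    (f : ℂ → HA L e dV hdV dW hdW → ℂ) (hstd : IsStandardSectionFamily 𝒦 χ f) (hcont : ∀ s, Continuous (f s))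
    {S : Set (HeightOneSpectrum (𝓞 ↥(maximalRealSubfield L)))} (hS : S.Finite) (hur : ∀ v ∉ S, (quadraticHeckeCharCM L).IsUnramifiedAt v)
    (E : ℂ → HA L e dV hdV dW hdW → ℂ) (hEd : ∀ x : HA L e dV hdV dW hdW, DifferentiableOn ℂ (fun s : ℂ => E s x) {s : ℂ | 0 < s.re})
    (hEeq : ∀ (s : ℂ) (x : HA L e dV hdV dW hdW), (n : ℝ) / 2 < s.re →
      E s x = (partialStandardL S (fun _ => {1}) (2 * s + 1) * partialStandardL S (fun v => {(quadraticHeckeCharCM L).valueAtUniformizer v}) (2 * s + 2)) /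
          (partialStandardL S (fun _ => {1}) (2 * s) * partialStandardL S (fun v => {(quadraticHeckeCharCM L).valueAtUniformizer v}) (2 * s - 1)) *
        intertwiningDelta L e dV hdV dW hdW νN (f s) x) :
    ∃ Ec₈ : ℂ → HA L e dV hdV dW hdW → ℂ,
      (∀ h : HA L e dV hdV dW hdW, DifferentiableOn ℂ (fun s => Ec₈ s h) {s : ℂ | 0 < s.re}) ∧
      (∀ s : ℂ, 0 < s.re → Continuous (Ec₈ s)) ∧
      (∀ (s : ℂ) (h : HA L e dV hdV dW hdW), (n : ℝ) / 2 < s.re →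
        Ec₈ s h = (s - 1 / 2) * intertwiningDelta L e dV hdV dW hdW νN (f s) h) ∧
      (∀ z : ℂ, 0 < z.re → ∃ C A ρ : ℝ, 0 < ρ ∧ ∀ s : ℂ, dist s z < ρ → ∀ h : HA L e dV hdV dW hdW,
        ‖Ec₈ s h‖ ≤ C * adelicHeightGL (n + n) L (h : GL (Fin (n + n)) (AdeleRing (𝓞 L) L)) ^ A) := by
  obtain ⟨Ec₈, h1, h2, h4, h5⟩ := exists_bigCell_termPackage_cm L e dV hdV dW hdW hn hdV0 hdW0 𝒦 νN χ hχ f hstd hcont hS hur E hEd hEeq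
  exact ⟨Ec₈, h1, h2, fun s h hs => by rw [h4 s h hs, prod_singleton_half], h5⟩

end Summit.HodgeConjecture.HodgeConjecture.Cruxes.HLiu418.K2LiuSiegelEisensteinBigCellTermPackageCM

end
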